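import Mathlib
import HarnessLib
import HarnessLib.Audit
import Summits.AtomisticToContinuum.Statement
import Literature.Geometry.DiscreteGeometry.KissingPatterns
import Literature.Barriers.AtomisticToContinuum.TetrahedralFrustration

/-!
Route: ReggeStarBounds

CLOSED (retired) 2026-08-15T13:45:48Z by operator:999:1257524 — reason: not-a-thesis: assembly does not conclude the sub-problem Statement — note: D-0027 §2.1 audit (human 2026-08-15: routes that do not decide the summit are removed): the assembly concludes `Literature.MathematicalPhysics.StatisticalMechanics.Crystallization`, not the sub-problem statement; a NEW conforming route may be opened from the same idea (generated `closes : … → _root_. The file is kept as the record of this route; refuted decls are indexed as negative knowledge (`ledger negatives`).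

Route ReggeStarBounds — realises idea card regge-froth-statistics-lower-bounds ("the 3-D discrete
Gauss–Bonnet is edge flatness").

X (STAR COERCIVITY; it suffices to show): there are g > 0 and C such that for EVERY finite
configuration x of N distinct points in ℝ³,
   E_LJ(x) ≥ N·e_per + g·#{i : the first shell of x_i is 1/20-DEFECTIVE} − C·N^(2/3),
where e_per := ⨅ over periodic configurations Q of the Lennard-Jones energy per particle (V =
r⁻¹²/12 − r⁻⁶/6, Blanc–Lewin units; e_per ≈ e(hcp) ≈ −0.7175 = −8.61ε/12), and particle i is
1/20-defective unless its recentred shell {x_j − x_i : |x_j − x_i| ≤ 6/5}, rescaled by some a ∈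
[9/10, 11/10], is 1/20-matched after a rotation to the FCC kissing pattern (cuboctahedron) or the
HCP pattern (anticuboctahedron) — tree predicates ShellCloseTo / fccKissingPattern /
hcpKissingPattern.

MECHANISM (the card): transplant De Luca–Friesecke's discrete Gauss–Bonnet proof to 3-D with the
dictionary vertex angle deficit ↦ edge dihedral deficit (Regge), Euler ↦ FLATNESS: in any
tetrahedralisation the normalised solid angles at an interior vertex sum to 1 and the normalised
dihedral angles around an interior edge sum to 1. Hence two exact, potential-independent identities
on a Delaunay triangulation: N = Σ_t ω(t) (ω = sum of the four solid-angle fractions) and E_bonds =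
Σ_t ε(t) (ε = dihedral-fraction-weighted edge energies; Coxeter's froth bookkeeping), plus a charge
of non-Delaunay pairs to the cells their segment crosses. A lower bound then follows from ONE
inequality per cell, and sharper ones from LPs over edge-stars (flatness Σθ = 2π exact; 5·70.53° =
352.6° cannot close) and vertex-stars, certified by exact rational LP + interval rounding. X is the
statement that some finite star level is sharp ON AVERAGE with slack g off the close-packed stars.

X → Crystallization: X ∧ CrysEnergyUpper (0629, trial states) ⇒ liminf E(N)/N ≥ e_per ≥ limsup, and
g·#defects ≤ o(N) ⇒ ZeroDefectDensity (all but o(N) particles of ground states have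
1/20-close-packed first shells) ⇒ [hull exactification cascade, other routes: layer propagation,
Hägg domination 0737, harmonic last mile] IsCrystallizing ∧ periodic minimum attained ⇒
HasPeriodicGroundStateEnergy (limit = e(P)) ⇒ Crystallization.

Lean (X = decl StarCoercivity): ∃ g : ℝ, 0 < g ∧ ∃ C : ℝ, ∀ (N : ℕ) (x : Fin N → EuclideanSpace ℝ
(Fin 3)), Function.Injective x → (N : ℝ) * (⨅ Q :
Literature.MathematicalPhysics.StatisticalMechanics.PeriodicConfiguration 3, Q.energyPerParticle
Literature.MathematicalPhysics.StatisticalMechanics.lennardJones) + g * (Nat.card {i : Fin N // ¬ ∃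
a : ℝ, 9 / 10 ≤ a ∧ a ≤ 11 / 10 ∧ (Literature.Geometry.DiscreteGeometry.ShellCloseTo (1 / 20)
((Finset.univ.filter fun j : Fin N => j ≠ i ∧ dist (x i) (x j) ≤ 6 / 5).image fun j => a⁻¹ • (x j -
x i)) Literature.Geometry.DiscreteGeometry.fccKissingPattern ∨
Literature.Geometry.DiscreteGeometry.ShellCloseTo (1 / 20) ((Finset.univ.filter fun j : Fin N => j ≠
i ∧ dist (x i) (x j) ≤ 6 / 5).image fun j => a⁻¹ • (x j - x i))
Literature.Geometry.DiscreteGeometry.hcpKissingPattern)} : ℝ) - C * (N : ℝ) ^ (2 / 3 : ℝ) ≤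
Literature.MathematicalPhysics.StatisticalMechanics.interactionEnergy
Literature.MathematicalPhysics.StatisticalMechanics.lennardJones x

Rationale: WHY THIS LINE. Every 2-D crystallization proof is combinatorial at heart (HeitmannRadin1980;
LucaFriesecke2016: Euler's formula shares each bond's energy among faces and bounds the bond count).
In 3-D Euler on the bond graph is useless, but Regge calculus says what replaces it: flat space ⟺
zero deficit at every EDGE. Written as volume fractions this gives exact partition-of-unity
identities on any Delaunay triangulation (solid-angle fractions at a vertex sum to 1, dihedral
fractions round an edge sum to 1), so N and the bond energy become sums of ANGLE-WEIGHTED simplex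
functionals (Coxeter1958's froth statistics, which predicted coordination 13.56 for ideal
tetrahedral packing; Rogers1958 = the density case at level 1). Tetrahedral frustration then enters
as a LINEAR constraint in angle-statistics space (5θ_tet = 352.6° < 360° < 6θ_tet, tree:
five_mul_lt_two_pi / two_tet_add_two_oct) instead of as an enemy, and lower bounds on e*_LJ(3D)
become finite LPs over edge-stars and vertex-stars, certifiable by rational LP duals + interval
arithmetic (kit). Imported areas: discrete differential geometry (Regge/Gauss–Bonnet), computational
geometry (Delaunay, slivers), LP duality / certified computation (Hales1992, Hales1997 ran exactly
this for DENSITY). Cone facts used are PROVED: tetDihedralAngle bounds,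
LennardJonesMinimalDistance_holds (δ = 1/3), BlancLewin2015_8_holds (e_∞ exists),
lennardJones_stable_holds, LennardJonesGroundStatesExist_holds; no unproved named fact is in the
import cone.
RANKED CRUXES. (2) StarCoercivity — the bet: a finite star level is sharp on average with slack g
off FCC/HCP shells; output typed mechanism-free (same shape as LinkCensus.ChargedEnergyGap 3510 but
with the metric ShellCloseTo defect at tolerance 1/20, which is what the exactification cascade
consumes). (3) StabilityConstantTwelve — the unconditional rung: E(N) ≥ −N for all N, i.e.
Yuhjtman2015's stability constant 14.316 improved to 12 (truth ≈ 8.61); level 1–2 cells + tail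
charge, no sharpness needed; the first thing provers/kit should attack. (4) PeriodicStarCoercivity —
the torus twin (no boundary, flatness exact at every vertex/edge), feeding 0627 /
RefuteCrystalPeriodicMin's reduction "inf over periodic = inf over mostly-Barlow periodic".
SUPPORT (typed): SolidAngleFlatness, DihedralFlatness (the identities' measure-theoretic core,
provable now); LevelOneFrustrationGap (certified number: regular unit simplex ε/ω = −θ/(4(3θ−π)) ≈
−0.5582 < −0.5195 = 6V(1)+V(√2), fcc's Delaunay-edge energy per particle — the energy twin of σ₃ >
π/√18: level 1 leaks ≥ 7%); SliverCellsUnbounded (raw per-simplex bounds are −∞: flat Delaunay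
slivers keep ε ≈ V(√2) < 0 while ω → 0, so cells must be merged/stars used — the card's fastest
refutation, recorded as a lemma); CrysEnergyUpper (shared 0629); ZeroDefectDensity +
CoercivityForcesZeroDefects (real-analysis glue); ZeroDefectDensityCrystallizes (the bridge = hull
exactification cascade + Hägg domination + harmonic stability, owned by routes
LinkCensus/HullPeriodicPoint/KarpPeierls… — declared, not claimed here).
KILL CRITERIA. (a) A primal witness: a translation-invariant star statistics (e.g. icosahedral
5-rings mixed with 6-rings at Coxeter's ratio, or a Frank–Kasper phase) that satisfies every level-3
flatness/consistency constraint with energy + tail charge < e(hcp) − 3% ⇒ stars provably too local ⇒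
StarCoercivity unprovable by this mechanism ⇒ close exhausted after recording the certified ℓ_k
(StabilityConstantTwelve may still close). (b) Numerics/theorem showing a non-close-packed periodic
structure within g → 0 of e(hcp) refutes StarCoercivity/PeriodicStarCoercivity outright (and most
sphere-packing-heritage routes). (c) StabilityConstantTwelve is refuted only by e_∞ < −1 (excluded
by all cluster numerics).
NOT DECOMPOSED YET (by design, D-0019): Delaunay triangulation existence/periodic version
(definition request filed), the cell-merging rule for slivers (ε-cospherical clusters → Delaunay
polytopes incl. octahedra), the apportioning of simplex scores to edge/vertex stars, the tail charge
beyond the second shell, the LP discretisation with Lipschitz slack and its kit certification,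
boundary bookkeeping (expected unnecessary: vacuum cells have positive score −ℓ·ω). All become
children of crux 2/3 by glued splits once one of them moves.
SOURCES: LucaFriesecke2016 (arXiv:1605.00034); Coxeter1958 (doi:10.1215/ijm/1255448337); Rogers1958;
Hales1992, Hales1993, Hales1997 (Delaunay stars, 8 pt, pentahedral prism 0.740873); HalesDSP2012 Ch.
6 (Rogers/Marchal cells); Lagarias2002LocalDensity (taxonomy of local inequalities); Yuhjtman2015
(arXiv:1501.05248, Thm 9: B ≤ 14.316, d_min ≥ 0.684); DelimaProcacciYuhjtman2015 §5.2;
BlancLewin2015 §2.1–2.3; barrier files TetrahedralFrustration, IcosahedralClusters,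
FlexibleKissingArrangements (tree).

Novelty: Nearest prior art (searched: the card's own audit trail re-read; this session: crossref + zbMATH
"stability constant Lennard-Jones" (Yuhjtman2015 doi:10.1007/s10955-015-1300-3 = arXiv:1501.05248 is
still the record, quoted as "8.61 ≤ B_LJ ≤ 14.316" in DelimaProcacciYuhjtman2015 arXiv:1503.04221
§5.2 and Procacci 2022 arXiv:2005.10362; no later improvement found; OpenAlex/S2/arXiv APIs 429),
lit --hybrid "Delaunay simplex dihedral angle weights lower bound energy pair potential" (only
HalesDSP2012 Ch. 6 and Coxeter's Twelve Essays surface), lit read of Yuhjtman2015 pp. 3, 9 (method =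
one-centre subharmonic ball averages, radius 0.49), sibling routes opened today (LinkCensus: Euler
census on vertex links; FrustrationRangeLP: unimodular marginal hierarchy; SteepnessLadderOneCentre,
MieLadderVdwKissing: one-centre engines).
(1) De Luca–Friesecke 2017 (LucaFriesecke2016, doi:10.1007/s00332-017-9401-6): the 2-D template —
bond energy shared among faces via Euler/Gauss–Bonnet. (2) Coxeter1958 "Close-packing and froth"
(dihedral-angle statistics of ideal tetrahedral packing, {3,3,5.1…}, coordination 13.56) and
Rogers1958 (solid-angle partition of unity ⇒ simplex DENSITY bound σ₃) — level 1 of this route is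
their energy analogue. (3) Hales1992/Hales1993/Hales1997: Delaunay stars scored by compression,
local optimality of fcc/hcp stars, interval LPs — the density precedent of levels 2–3, abandoned
because stars leak (pentahedral prism ≈ 0.740873 > 0.74048; tree: delaunayStarBound_penta  [refs: 10.1007/s10955-015-1300-3, 10.1007/s00332-017-9401-6, 1501.05248, 1503.04221, 2005.10362, doi:10.1007/s10955-015-1300-3, doi:10.1007/s00332-017-9401-6, Yuhjtman2015, DelimaProcacciYuhjtman2015, HalesDSP2012, LucaFriesecke2016, Coxeter1958, Rogers1958, Hales1992, Hales1993, Hales1997]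

Barriers (technique_class: regge-angle-weights delaunay-star-lp rogers-simplex-bound): technique_class: regge-angle-weights delaunay-star-lp rogers-simplex-bound
- Literature.Barriers.AtomisticToContinuum.TetrahedralFrustration: APPLIES HEAD-ON to level 1 — a
raw per-simplex energy bound is exactly a "pure Delaunay-simplex bound" and is not sharp: recorded
quantitatively as support LevelOneFrustrationGap (−0.5582 < −0.5195, the energy twin of σ₃ = 0.7797
> 0.7405) and SliverCellsUnbounded (raw level 1 = −∞). Evasion = the barrier's own scope caveat
(Lagarias2002LocalDensity Remark (2): only volume-independent single-cell functionals with no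
reapportioning are obstructed): levels 2–3 reapportion simplex scores across edge-stars and
vertex-stars where flatness COUPLES simplices (2θ_tet + 2θ_oct = 2π is visible; tree
two_tet_add_two_oct), i.e. a hybrid in Hales's sense. Residual risk declared: Hales's Delaunay-star
programme for density leaked at the 5e-4 level (0.740873, tree
delaunayStarBound_pentahedralPrism_bounds); the energy functional has a different objective (pair
energies at two shells + tail charge, not covered volume) and a 1e-2 margin against
icosahedral/Frank–Kasper order to spend, but sharpness at level 3 is the bet, not a given.
- Literature.Barriers.AtomisticToContinuum.TetrahedralFrustrationNarrow: APPLIES exactly to RAW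
level 1 (volume-independent single-cell bound: one simplex, no reapportioning) — and the route
records that level 1 fails quantitatively (LevelOneFrustrationGap, SliverCellsUnbounded); every
claimed bound (StabilityConstantTwelve

History (route lifecycle, newest last):
- 2026-08-15T13:45:48Z · CLOSED retired — not-a-thesis: assembly does not conclude the sub-problem Statement (operator:999:1257524)

sub-problem: Crystallization · status: closed(retired) · opened planner-plancard-AtomisticToContinuum-Crystal-8fa53ff6-0 2026-08-15T11:26:14Z · rev 0 · ledger route-AtomisticToContinuum-ReggeStarBounds
GENERATED by the gate from the ledger (D-0016/17). Provers cite these decls: `theorem foo : Summit.AtomisticToContinuum.Crystallization.Theses.ReggeStarBounds.<Decl> := …` in Summits/AtomisticToContinuum/Crystallization/Theorems/<Name>.lean.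
-/

namespace Summit.AtomisticToContinuum.Crystallization.Theses.ReggeStarBounds

open scoped BigOperators Topology Manifold Classical MeasureTheory ProbabilityTheory Matrix InnerProductSpace ComplexConjugate ContinuousMap
open Filter Set Function TopologicalSpace MeasureTheory

attribute [summit_statement] _root_.Crystallization

/-- item stmt-AtomisticToContinuum-3938 · crux · rank 2 · closed · moot by None · by planner
why it might fail: Truth needs a uniform LJ energy gap between close packing and every 1/20-defective local order (FK/icosahedral lose ~1e-2, 5%-strained fcc ~1e-2: believed, unproved). PROVABILITY by finite-level star LPs is the bet: Hales's Delaunay-star density programme leaked (0.740873>0.74048); slivers; tail.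
sources: LucaFriesecke2016, Coxeter1958, Rogers1958, Hales1992, Hales1997, HalesDSP2012
[crux] STAR COERCIVITY (thesis X). For every finite configuration of distinct points: E_LJ(x) ≥
N·e_per + g·#(1/20-defective first shells) − C·N^(2/3), e_per = ⨅ periodic energy per particle;
defect = recentred shell within 6/5, rescaled by a ∈ [0.9, 1.1], not 1/20-matched after rotation to
fccKissingPattern/hcpKissingPattern (so Barlow sites at any dilation are free; surface,
over/under-coordinated, icosahedral (1/40-far, FlexibleKissingArrangements) and ≥5%-strained sites
are charged). INTENDED PROOF (the card's mechanism, deliberately not yet decomposed): Delaunay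
triangulation + 4 far ghost vertices; flatness identities N = Σ_t ω(t), E_bonds = Σ_t ε(t)
(SolidAngleFlatness/DihedralFlatness) with ω = solid-angle fractions, ε = dihedral-fraction-weighted
edge energies (Coxeter1958/Regge bookkeeping); non-Delaunay pairs charged to crossed cells; slivers
merged into ε-cospherical Delaunay polytopes (SliverCellsUnbounded shows why); then a level-k
inequality per edge-star/vertex-star 'score ≥ g·[defect share]' proved as a certified LP dual
(rational LP + interval slack, kit) — vacuum cells have positive score −e_per·ω, so no separate
boundary term is expected (C is slack). Same logic -/
@[route_item "route-AtomisticToContinuum-ReggeStarBounds"]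
def StarCoercivity : Prop :=
  ∃ g : ℝ, 0 < g ∧ ∃ C : ℝ, ∀ (N : ℕ) (x : Fin N → EuclideanSpace ℝ (Fin 3)), Function.Injective x → (N : ℝ) * (⨅ Q : Literature.MathematicalPhysics.StatisticalMechanics.PeriodicConfiguration 3, Q.energyPerParticle Literature.MathematicalPhysics.StatisticalMechanics.lennardJones) + g * (Nat.card {i : Fin N // ¬ ∃ a : ℝ, 9 / 10 ≤ a ∧ a ≤ 11 / 10 ∧ (Literature.Geometry.DiscreteGeometry.ShellCloseTo (1 / 20) ((Finset.univ.filter fun j : Fin N => j ≠ i ∧ dist (x i) (x j) ≤ 6 / 5).image fun j => a⁻¹ • (x j - x i)) Literature.Geometry.DiscreteGeometry.fccKissingPattern ∨ Literature.Geometry.DiscreteGeometry.ShellCloseTo (1 / 20) ((Finset.univ.filter fun j : Fin N => j ≠ i ∧ dist (x i) (x j) ≤ 6 / 5).image fun j => a⁻¹ • (x j - x i)) Literature.Geometry.DiscreteGeometry.hcpKissingPattern)} : ℝ) - C * (N : ℝ) ^ (2 / 3 : ℝ) ≤ Literature.MathematicalPhysics.StatisticalMechanics.interactionEnergy Literature.MathematicalPhysics.StatisticalMechanics.lennardJones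 x

/-- item stmt-AtomisticToContinuum-3939 · crux · rank 3 · closed · moot by None · by planner
why it might fail: False only if e_∞ < −1 (all numerics: E(N)/N ≥ −0.72). The bet is certifiability: after sliver merging, the level-1/2 cell constant plus a rigorous bound on the non-Delaunay r⁻⁶ tail for 1/3-separated (not 0.684-separated) ground states must stay above −1; a poor tail constant eats the 0.2 margin.
sources: Yuhjtman2015, arXiv:1501.05248, DelimaProcacciYuhjtman2015, BlancLewin2015, Rogers1958, HalesDSP2012
[crux] STABILITY CONSTANT TWELVE — the unconditional rung of the same engine: E(N) ≥ −N for every N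
(Blanc–Lewin units, V = r⁻¹²/12 − r⁻⁶/6), i.e. Yuhjtman's stability constant B_LJ ≤ 14.316 (E/N ≥
−1.193; arXiv:1501.05248 Thm 9, one-centre subharmonic averaging over balls of radius 0.49) improved
to B_LJ ≤ 12; truth is B_LJ ≈ 8.61 (fcc/hcp, e_per ≈ −0.7175). Intended proof: level 1–2
angle-weighted cells on the Delaunay triangulation of a ground state (1/3-separated by
LennardJonesMinimalDistance_holds; 0.684 by Yuhjtman Cor., citable), sliver merging, and a crude
certified charge of the non-Delaunay r⁻⁶ tail (shell sum sum_inv_pow_six_le style); no sharpness, no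
coercivity. Level-1 raw numbers: regular unit simplex −0.5582 per unit weight for the bond part
(LevelOneFrustrationGap) vs the needed −1 + |tail| ≈ −0.75: margin ≈ 0.2 to spend on slivers and
tail. Deliverable (a) of the card; by BlancLewin2015_8_holds it is equivalent to e_∞ ≥ −1 and
implies e(Q) ≥ −1 for every periodic Q via trial blocks. -/
@[route_item "route-AtomisticToContinuum-ReggeStarBounds"]
def StabilityConstantTwelve : Prop :=
  ∀ N : ℕ, -(N : ℝ) ≤ Literature.MathematicalPhysics.StatisticalMechanics.groundStateEnergy Literature.MathematicalPhysics.StatisticalMechanics.lennardJones 3 N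

/-- item stmt-AtomisticToContinuum-3940 · crux · rank 4 · closed · moot by None · by planner
why it might fail: Must hold for ALL periodic P incl. non-separated, porous or huge-motif ones (positive core and vacuum cells must supply the slack); false if some non-close-packed periodic structure ties e(hcp); provability needs a periodic Delaunay triangulation API (none in Mathlib) and the tail charge.
sources: Coxeter1958, Hales1997, HalesDSP2012, BlancLewin2015, Stillinger2001, Literature.Barriers.AtomisticToContinuum.TetrahedralFrustration
[crux] PERIODIC STAR COERCIVITY — torus twin of X: there is g > 0 with e(P) ≥ e_per + g·(fraction of
1/20-defective motif points) for EVERY periodic configuration P of ℝ³ (defect as in StarCoercivity,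
shells read in P.points). On the torus ℝ³/G the Delaunay triangulation is finite and flatness holds
at EVERY vertex and edge, so the identities #F = Σ_t ω(t), E_bonds = Σ_t ε(t) are exact with no
boundary at all — the cleanest home of the mechanism. Use: near-minimising sequences of periodic
configurations are asymptotically defect-free (input to CrysPeriodicMinAttained 0627 via compactness
+ stacking selection, and to RefuteCrystalPeriodicMin's reduction 'inf over periodic = inf over
relaxed Barlow'); also the natural statement refuters can test on explicit periodic competitors
(bcc: defective everywhere, excess ≈ 0.03; A15/σ-type Frank–Kasper: excess ~1e-2). -/
@[route_item "route-AtomisticToContinuum-ReggeStarBounds"]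
def PeriodicStarCoercivity : Prop :=
  ∃ g : ℝ, 0 < g ∧ ∀ P : Literature.MathematicalPhysics.StatisticalMechanics.PeriodicConfiguration 3, (⨅ Q : Literature.MathematicalPhysics.StatisticalMechanics.PeriodicConfiguration 3, Q.energyPerParticle Literature.MathematicalPhysics.StatisticalMechanics.lennardJones) + g * ((P.motif.filter fun s => ¬ ∃ a : ℝ, 9 / 10 ≤ a ∧ a ≤ 11 / 10 ∧ (Literature.Geometry.DiscreteGeometry.ShellCloseTo (1 / 20) ((P.finite_inter_points (K := Metric.closedBall s (6 / 5) \ {s}) (Metric.isBounded_closedBall.subset Set.sdiff_subset)).toFinset.image fun y => a⁻¹ • (y - s)) Literature.Geometry.DiscreteGeometry.fccKissingPattern ∨ Literature.Geometry.DiscreteGeometry.ShellCloseTo (1 / 20) ((P.finite_inter_points (K := Metric.closedBall s (6 / 5) \ {s}) (Metric.isBounded_closedBall.subset Set.sdiff_subset)).toFinset.image fun y => a⁻¹ • (y - s)) Literature.Geometry.DiscreteGeometry.hcpKissingPattern)).card : ℝ) / (P.motif.card : ℝ) ≤ P.energyPerParticle Literature.MathematicalPhysics.StatisticalMechanics.l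ennardJones

/-- item stmt-AtomisticToContinuum-0629 · support · rank 4 · closed · moot by None · by planner
Easy half of energetic crystallization: limsup E(N)/N ≤ ⨅ over periodic configurations of the LJ
energy per particle (finite blocks of a near-optimal periodic configuration as trial states;
boundary O(N^{2/3}); r⁻⁶ tail summable in d = 3; needs BddBelow of the range, from LJ stability). -/
@[route_item "route-AtomisticToContinuum-ReggeStarBounds"]
def CrysEnergyUpper : Prop :=
  Filter.limsup (fun N : ℕ => Literature.MathematicalPhysics.StatisticalMechanics.groundStateEnergy Literature.MathematicalPhysics.StatisticalMechanics.lennardJones 3 N / N) Filter.atTop ≤ ⨅ Q : Literature.MathematicalPhysics.StatisticalMechanics.PeriodicConfiguration 3, Q.energyPerParticle Literature.MathematicalPhysics.StatisticalMechanics.lennardJones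

/-- item stmt-AtomisticToContinuum-3941 · support · rank 5 · closed · moot by None · by planner
[support] ZERO DEFECT DENSITY (derived statement, = H3 of card hull-exactification-cascade in metric
form): along every sequence of Lennard-Jones ground states the fraction of particles whose first
shell (radius 6/5, rescaled by a ∈ [0.9,1.1]) is not 1/20-close after rotation to the FCC or HCP
kissing pattern tends to 0. Follows from StarCoercivity + CrysEnergyUpper
(CoercivityForcesZeroDefects); consumed by ZeroDefectDensityCrystallizes. Filed as its own decl so
that other routes (LinkCensus ZeroChargeBulk 3509 is the census analogue) can want it by signature. -/
@[route_item "route-AtomisticToContinuum-ReggeStarBounds"]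
def ZeroDefectDensity : Prop :=
  ∀ x : (N : ℕ) → (Fin N → EuclideanSpace ℝ (Fin 3)), (∀ N, Literature.MathematicalPhysics.StatisticalMechanics.IsGroundState Literature.MathematicalPhysics.StatisticalMechanics.lennardJones (x N)) → Filter.Tendsto (fun N : ℕ => (Nat.card {i : Fin N // ¬ ∃ a : ℝ, 9 / 10 ≤ a ∧ a ≤ 11 / 10 ∧ (Literature.Geometry.DiscreteGeometry.ShellCloseTo (1 / 20) ((Finset.univ.filter fun j : Fin N => j ≠ i ∧ dist (x N i) (x N j) ≤ 6 / 5).image fun j => a⁻¹ • (x N j - x N i)) Literature.Geometry.DiscreteGeometry.fccKissingPattern ∨ Literature.Geometry.DiscreteGeometry.ShellCloseTo (1 / 20) ((Finset.univ.filter fun j : Fin N => j ≠ i ∧ dist (x N i) (x N j) ≤ 6 / 5).image fun j => a⁻¹ • (x N j - x N i)) Literature.Geometry.DiscreteGeometry.hcpKissingPattern)} : ℝ) / N) Filter.atTop (nhds 0)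

/-- item stmt-AtomisticToContinuum-3942 · support · rank 6 · closed · moot by None · by planner
[support] glue, elementary real analysis: StarCoercivity → CrysEnergyUpper → ZeroDefectDensity.
Proof: ground states are injective with E(x^N) = E(N); StarCoercivity gives g·#def ≤ E(N) − N·e_per
+ C N^(2/3); CrysEnergyUpper gives E(N)/N ≤ e_per + η eventually (upper boundedness of E(N)/N ≤ 0
from a far-apart trial pair; or use BlancLewin2015_8_holds for the limit), hence #def/N ≤ η/g + C
N^(−1/3)/g → 0. -/
@[route_item "route-AtomisticToContinuum-ReggeStarBounds"]
def CoercivityForcesZeroDefects : Prop :=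
  StarCoercivity → CrysEnergyUpper → ZeroDefectDensity

/-- item stmt-AtomisticToContinuum-3943 · support · rank 7 · closed · moot by None · by planner
sources: Hales2012, HalesDSP2012, BlancLewin2015, Radin1991
[support] THE BRIDGE (not this card's content; declared so the assembly is honest):
ZeroDefectDensity → IsCrystallizing lennardJones 3 ∧ (periodic minimum attained). Intended proof =
the hull exactification cascade of card hull-exactification-cascade: vague compactness of
1/3-separated empirical measures gives a hull configuration S with NO 1/20-defect; soft layer
propagation (LinkCensus SoftLayerPropagation 3513 / Hales DSP §1.3, tree
HalesDSP_layerPackings_holds for the exact case) makes S a relaxed Barlow stacking; cut-and-paste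
minimality in the hull + strict Hägg domination (0737, KarpPeierlsStackingLock,
PoissonBesselStacking) select a periodic stacking; harmonic stability removes residual strain; the
periodic P obtained attains e_per (periodisation 0715 + trial blocks 0629). Owned by those routes;
provers here should treat it as a hypothesis. -/
@[route_item "route-AtomisticToContinuum-ReggeStarBounds"]
def ZeroDefectDensityCrystallizes : Prop :=
  ZeroDefectDensity → Literature.MathematicalPhysics.StatisticalMechanics.IsCrystallizing Literature.MathematicalPhysics.StatisticalMechanics.lennardJones 3 ∧ ∃ P : Literature.MathematicalPhysics.StatisticalMechanics.PeriodicConfiguration 3, IsLeast (Set.range fun Q : Literature.MathematicalPhysics.StatisticalMechanics.PeriodicConfiguration 3 => Q.energyPerParticle Literature.MathematicalPhysics.StatisticalMechanics.lennardJones) (P.energyPerParticle Literature.MathematicalPhysics.StatisticalMechanics.lennardJones)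

/-- item stmt-AtomisticToContinuum-3944 · support · rank 9 · closed · moot by None · by planner
[support] 3-D GAUSS–BONNET IS FLATNESS, vertex form, as pure measure theory (no trigonometry): for
finitely many non-degenerate tetrahedra conv{v, p_k0, p_k1, p_k2} sharing the apex v with pairwise
disjoint interiors, the volume fractions of the unit ball at v inside their apex cones (= solid
angles/4π) sum to ≤ 1, with equality when the tetrahedra cover a neighbourhood of v. Proof: near v
each tetrahedron coincides with its cone; cones are dilation invariant; a.e.-disjointness +
additivity of volume. This is the identity N = Σ_t ω(t) behind the card (interior vertices of any
triangulation), and the inequality direction is the one lower bounds need. -/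
@[route_item "route-AtomisticToContinuum-ReggeStarBounds"]
def SolidAngleFlatness : Prop :=
  ∀ (n : ℕ) (v : EuclideanSpace ℝ (Fin 3)) (p : Fin n → Fin 3 → EuclideanSpace ℝ (Fin 3)), (∀ k, LinearIndependent ℝ (fun i => p k i - v)) → (∀ k l, k ≠ l → interior (convexHull ℝ (insert v (Set.range (p k)))) ∩ interior (convexHull ℝ (insert v (Set.range (p l)))) = ∅) → (∑ k, (volume (Metric.ball v 1 ∩ {q | ∃ c : Fin 3 → ℝ, (∀ i, 0 ≤ c i) ∧ q = v + ∑ i, c i • (p k i - v)})).toReal / (volume (Metric.ball v (1 : ℝ))).toReal ≤ 1) ∧ ((∃ r : ℝ, 0 < r ∧ Metric.ball v r ⊆ ⋃ k, convexHull ℝ (insert v (Set.range (p k)))) → ∑ k, (volume (Metric.ball v 1 ∩ {q | ∃ c : Fin 3 → ℝ, (∀ i, 0 ≤ c i) ∧ q = v + ∑ i, c i • (p k i - v)})).toReal / (volume (Metric.ball v (1 : ℝ))).toReal = 1)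

/-- item stmt-AtomisticToContinuum-3945 · support · rank 9 · closed · moot by None · by planner
[support] edge form (Regge: zero deficit angle at every interior edge of a flat triangulation): for
non-degenerate tetrahedra conv{v, w, p_k0, p_k1} sharing the edge vw with pairwise disjoint
interiors, the unit-ball volume fractions at v of their dihedral wedges ℝ(w−v) + cone(p_k0−v,
p_k1−v) (= dihedral angle/2π) sum to ≤ 1, with equality when the tetrahedra cover a neighbourhood of
the midpoint of vw. Gives E_bonds = Σ_t ε(t) with ε(t) = Σ_edges (θ_e,t/2π)·V(|e|) — Coxeter's froth
sharing of each bond among the simplices around it. -/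
@[route_item "route-AtomisticToContinuum-ReggeStarBounds"]
def DihedralFlatness : Prop :=
  ∀ (n : ℕ) (v w : EuclideanSpace ℝ (Fin 3)) (p : Fin n → Fin 2 → EuclideanSpace ℝ (Fin 3)), (∀ k, LinearIndependent ℝ ![w - v, p k 0 - v, p k 1 - v]) → (∀ k l, k ≠ l → interior (convexHull ℝ ({v, w} ∪ Set.range (p k))) ∩ interior (convexHull ℝ ({v, w} ∪ Set.range (p l))) = ∅) → (∑ k, (volume (Metric.ball v 1 ∩ {q | ∃ s : ℝ, ∃ c : Fin 2 → ℝ, (∀ i, 0 ≤ c i) ∧ q = v + s • (w - v) + ∑ i, c i • (p k i - v)})).toReal / (volume (Metric.ball v (1 : ℝ))).toReal ≤ 1) ∧ ((∃ r : ℝ, 0 < r ∧ Metric.ball (midpoint ℝ v w) r ⊆ ⋃ k, convexHull ℝ ({v, w} ∪ Set.range (p k))) → ∑ k, (volume (Metric.ball v 1 ∩ {q | ∃ s : ℝ, ∃ c : Fin 2 → ℝ, (∀ i, 0 ≤ c i) ∧ q = v + s • (w - v) + ∑ i, c i • (p k i - v)})).toReal / (volume (Metric.ball v (1 : ℝ))).toReal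 = 1)

/-- item stmt-AtomisticToContinuum-3946 · support · rank 9 · closed · moot by None · by planner
sources: Rogers1958, HalesDSP2012, Literature.Barriers.AtomisticToContinuum.TetrahedralFrustration
[support] certified number, deliverable (b) of the card at level 1 (energy twin of
fccDensity_lt_rogersBound): the regular unit tetrahedron's angle-weighted energy per unit
particle-weight, ε/ω = 6(θ/2π)V(1) / (4(3θ−π)/4π) = −θ/(4(3θ−π)) ∈ (−0.55824, −0.55816) with θ =
tetDihedralAngle = arccos(1/3) (tree bounds tetDihedralAngle_bounds), lies strictly below 6·V(1) +
V(√2) = −1/2 + 1/768 − 1/48 = −0.51953…, the Delaunay-edge energy per particle of the unit fcc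
lattice (6 nearest-neighbour edges + 1 octahedral diagonal per particle). So a pure per-simplex
bound leaks by ≥ 7% for the bond energy (Rogers: 5% for density) — the TetrahedralFrustration
barrier made quantitative for energy; provable now by interval arithmetic from
tetDihedralAngle_bounds. -/
@[route_item "route-AtomisticToContinuum-ReggeStarBounds"]
def LevelOneFrustrationGap : Prop :=
  -(Real.arccos (1 / 3) / (4 * (3 * Real.arccos (1 / 3) - Real.pi))) < 6 * Literature.MathematicalPhysics.StatisticalMechanics.lennardJones 1 + Literature.MathematicalPhysics.StatisticalMechanics.lennardJones (Real.sqrt 2)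

/-- item stmt-AtomisticToContinuum-3947 · support · rank 9 · closed · moot by None · by planner
[support] negative knowledge, the card's 'fastest refutation' of RAW level 1 recorded as a lemma:
for every ℓ there is a non-degenerate tetrahedron with all six edge lengths in [1, 2] whose
dihedral-weighted LJ edge energy ε(p) (wedge volume fractions × V) is < ℓ × its total solid-angle
weight ω(p) (cone volume fractions). Witness: slivers — four points of a unit square lifted by h →
0: the two diagonals get dihedral fraction → 1/2 each (ε → V(√2) = −0.0195 < 0) while all four solid
angles → 0. Hence cells must be merged (ε-cospherical Delaunay polytopes, e.g. fcc octahedra) or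
scores apportioned to stars before any LP; this is why StarCoercivity is stated at star level. -/
@[route_item "route-AtomisticToContinuum-ReggeStarBounds"]
def SliverCellsUnbounded : Prop :=
  ∀ ℓ : ℝ, ∃ p : Fin 4 → EuclideanSpace ℝ (Fin 3), AffineIndependent ℝ p ∧ (∀ i j, i ≠ j → 1 ≤ dist (p i) (p j) ∧ dist (p i) (p j) ≤ 2) ∧ (∑ i : Fin 4, ∑ j ∈ Finset.Ioi i, (volume (Metric.ball (p i) 1 ∩ {q | ∃ s : ℝ, ∃ c : Fin 4 → ℝ, (∀ k, 0 ≤ c k) ∧ q - p i = s • (p j - p i) + ∑ k, c k • (p k - p i)})).toReal / (volume (Metric.ball (p i) (1 : ℝ))).toReal * Literature.MathematicalPhysics.StatisticalMechanics.lennardJones (dist (p i) (p j))) < ℓ * ∑ i : Fin 4, (volume (Metric.ball (p i) 1 ∩ {q | ∃ c : Fin 4 → ℝ, (∀ k, 0 ≤ c k) ∧ q - p i = ∑ k, c k • (p k - p i)})).toReal / (volume (Metric.ball (p i) (1 : ℝ))).toReal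

/-- item stmt-AtomisticToContinuum-3948 · assembly · rank 1 · closed · moot by None · by planner
[assembly] StarCoercivity → CrysEnergyUpper → CoercivityForcesZeroDefects →
ZeroDefectDensityCrystallizes → Crystallization. Proof: the two glue hypotheses give
ZeroDefectDensity, then IsCrystallizing ∧ ∃ P IsLeast; ⨅ = e(P) (IsLeast.csInf_eq); StarCoercivity
with the g-term dropped and LennardJonesGroundStatesExist_holds gives liminf E(N)/N ≥ e(P),
CrysEnergyUpper gives limsup ≤ e(P) (or identify the limit of BlancLewin2015_8_holds), so Tendsto
E(N)/N → e(P) and HasPeriodicGroundStateEnergy; conclude as in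
crystallization_of_isLeast_tendsto_isCrystallizing. -/
@[route_item "route-AtomisticToContinuum-ReggeStarBounds"]
def Assembly : Prop :=
  StarCoercivity → CrysEnergyUpper → CoercivityForcesZeroDefects → ZeroDefectDensityCrystallizes → Literature.MathematicalPhysics.StatisticalMechanics.Crystallization

end Summit.AtomisticToContinuum.Crystallization.Theses.ReggeStarBounds
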